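import Summits.QuantumFields.BalabanUV.Beta.SymSliceProjectorKernel
import Summits.QuantumFields.BalabanUV.Beta.KernelOrthoProjectorReindex
import Summits.QuantumFields.BalabanUV.Beta.SymmetrisedDressingReflection

/-!
# `BalabanUV.Beta.SymSliceProjectorRefl` — binder row D1, JSB12SYM-SPINE v1.2 D-K4-3 (brick K1b-5, reflection half): `refK (Φ N α) (symEc N) = symEc N`
# (`N` odd) — THE SYMMETRISED SLICE PROJECTOR IS REFLECTION-INVARIANT AT THE CENTRED ROOT (the `hR`-letter of the slice itself)

Under the axis reflection `α` (sites `sref α`, bond base points `bref α κ`, orientation signs `reflSign α κ`) the constraint matrix transforms as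
`Gmat (z̄) (j̄) = ε_j · Gmat z j` (S1e `symTreeGaugeAt_R1`, `N` odd so the centred root is fixed), i.e. `Gmat.submatrix cRef bRef = Gmat * S` with the
diagonal sign matrix `S`; hence `Pmat (ī) (j̄) = ε_i ε_j Pmat i j` (`kerProj_submatrix`, `kerProj_mul_orthogonal`), hence `refK (Φ N α) symEc = symEc`.
HONEST FRAMING (cell contract, verbatim): «discharging `BetaPertH` makes Bałaban's UV stability UNCONDITIONAL — a real constructive-QFT
result; it is NOT the continuum limit and NOT the Clay problem.»  [folklore] bookkeeping of OUR objects; discharges NOTHING of row D1; JsB12Sym 0∕4.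
0 sorry, 0 `def … : Prop`, nothing cited.  NOT D1, NOT BetaPertH, NOT continuum, NOT Clay.
HONEST DEPENDENCY (verbatim): «continuum YM on T⁴ ⇐ BetaPertH ∧ nine spine estimates (0/9 proved); BetaPertH ⇐ (D1) ∧ (D4) ∧ CAP+tail;
G-an2-4 gates asym, D1 and NE2/3/4.»  Unit `b2b-balaban-beta-an2` gen 25 (row-D1 owner), 2026-08-21.
-/

namespace Summit.QuantumFields.BalabanUV.Beta.SymSliceProjectorRefl

noncomputable section

open Finset Matrix
open scoped BigOperators Nat
open Literature.MathematicalPhysics.QuantumFieldTheory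
open Literature.MathematicalPhysics.QuantumFieldTheory.Balaban1983to89
open Literature.MathematicalPhysics.QuantumFieldTheory.Balaban1983to89.Beta
open Literature.Probability.LatticeModels (Torus.proj)
open ExpKernelCalculus (MKer)
open AffineAveraging (Form0 Form1 Site box toSite unitVec unitVec_apply)
open AveragingContours (blk off off_mem_box blk_add_off blk_block shift)
open AveragingContoursRooted (ctr ctrOff ctrOff_mem_box)
open RootedComb (ctr_eq_toSite blk_sref sref_root_ctr)
open PolarizationSign (reflSign)
open KernelReflection (LegMap refK refK_apply)
open ResolventReflection
open OneStepResolventKernel (Fib)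
open Summit.QuantumFields.BalabanUV.Beta.AxialDressingRooted (bondInd bondInd_apply R1_bondInd)
open Summit.QuantumFields.BalabanUV.Beta.SymmetrisedAxialPotential
open Summit.QuantumFields.BalabanUV.Beta.SymmetrisedAxialReflection
open Summit.QuantumFields.BalabanUV.Beta.SymmetrisedDressingMatrix
open Summit.QuantumFields.BalabanUV.Beta.SymmetrisedDressingReflection (symTreeGaugeAt_mulLeft)
open Summit.QuantumFields.BalabanUV.Beta.KernelOrthoProjector
open Summit.QuantumFields.BalabanUV.Beta.KernelOrthoProjectorReindex
open Summit.QuantumFields.BalabanUV.Beta.SymSliceBlockMatrix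
open Summit.QuantumFields.BalabanUV.Beta.SymSliceProjectorKernel

variable {d : ℕ}

/-! ## §1 The reflected offsets -/

/-- [our object] THE REFLECTED OFFSET OF AN INTERIOR BOND `(a, c)`: coordinate `α` becomes `N − 1 − c_α` (`a ≠ α`) or `N − 2 − c_α` (`a = α`, the bond is
re-based at its other endpoint). -/
def bbflip (α : Fin (d + 1)) (N : ℕ) (a : Fin (d + 1)) (c : Fin (d + 1) → ℕ) : Fin (d + 1) → ℕ :=
  fun i => if i = α then (if a = α then N - 2 - c i else N - 1 - c i) else c i

/-- [folklore] Entries of the reflected offset. -/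
theorem bbflip_apply (α : Fin (d + 1)) (N : ℕ) (a : Fin (d + 1)) (c : Fin (d + 1) → ℕ) (i : Fin (d + 1)) :
    bbflip α N a c i = if i = α then (if a = α then N - 2 - c i else N - 1 - c i) else c i := rfl

/-- [folklore] The reflected offset of an interior bond is an interior bond. -/
theorem bbflip_mem {α : Fin (d + 1)} {N : ℕ} {a : Fin (d + 1)} {c : Fin (d + 1) → ℕ} (h : (a, c) ∈ bIdxSet (d + 1) N) :
    (a, bbflip α N a c) ∈ bIdxSet (d + 1) N := by
  rw [mem_bIdxSet] at h ⊢
  obtain ⟨hb, hlt⟩ := h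
  dsimp only at hb hlt ⊢
  rw [mem_box] at hb
  refine ⟨mem_box.2 fun i => ?_, ?_⟩
  · rw [bbflip_apply]
    have := hb i
    split_ifs <;> omega
  · rw [bbflip_apply]
    have := hb a
    have hα := hb α
    split_ifs <;> omega

/-- [folklore] The reflected offset map is an involution on interior bonds. -/
theorem bbflip_bbflip {α : Fin (d + 1)} {N : ℕ} {a : Fin (d + 1)} {c : Fin (d + 1) → ℕ} (h : (a, c) ∈ bIdxSet (d + 1) N) :
    bbflip α N a (bbflip α N a c) = c := by
  rw [mem_bIdxSet] at h
  obtain ⟨hb, hlt⟩ := h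
  dsimp only at hb hlt
  rw [mem_box] at hb
  funext i
  rw [bbflip_apply, bbflip_apply]
  have := hb i
  have hα := hb α
  by_cases hi : i = α
  · subst hi
    by_cases ha : a = i
    · subst ha; simp only [if_true]; omega
    · simp only [if_true, if_neg ha]; omega
  · simp only [if_neg hi]

/-- [folklore] **THE REFLECTED BASE POINT OF AN INTERIOR BOND, BLOCKWISE**: `bref α a (N•B + toSite c) = N • sref α B + toSite (bbflip α N a c)`. -/
theorem bref_block {α : Fin (d + 1)} {N : ℕ} {a : Fin (d + 1)} {c : Fin (d + 1) → ℕ} (h : (a, c) ∈ bIdxSet (d + 1) N) (B : Fin (d + 1) → ℤ) :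
    bref α a ((N : ℤ) • B + toSite c) = (N : ℤ) • sref α B + toSite (bbflip α N a c) := by
  have h' := h
  rw [mem_bIdxSet] at h'
  obtain ⟨hb, hlt⟩ := h'
  dsimp only at hb hlt
  have hbi := mem_box.1 hb
  unfold bref
  rw [sref_block α hb B]
  funext i
  rw [Pi.sub_apply, Pi.add_apply, Pi.add_apply, toSite_bflip α hb, toSite_apply, bbflip_apply]
  by_cases hi : i = α
  · subst hi
    have := hbi i
    by_cases ha : a = i
    · subst ha
      rw [if_pos rfl, if_pos rfl, if_pos rfl, if_pos rfl, unitVec_apply, if_pos rfl]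
      omega
    · rw [if_pos rfl, if_neg ha, if_pos rfl, if_neg ha, Pi.zero_apply]
      omega
  · rw [if_neg hi, if_neg hi]
    by_cases ha : a = α
    · rw [if_pos ha, unitVec_apply, if_neg hi]; ring
    · rw [if_neg ha, Pi.zero_apply]; ring

/-- [folklore] Hence: the block of the reflected base point of an interior bond is the reflected block … -/
theorem blk_bref_of_int {α : Fin (d + 1)} {N : ℕ} (hN : 1 ≤ N) {a : Fin (d + 1)} {x : Fin (d + 1) → ℤ} (h : IsIntBond N a x) :
    blk N (bref α a x) = sref α (blk N x) := by
  have e : bref α a x = (N : ℤ) • sref α (blk N x) + toSite (bbflip α N a (off N x)) := by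
    conv_lhs => rw [← blk_add_off hN x]
    exact bref_block h (blk N x)
  rw [e]
  exact blk_block _ (mem_bIdxSet.1 (bbflip_mem h)).1

/-- [folklore] … and its offset is the reflected offset. -/
theorem off_bref_of_int {α : Fin (d + 1)} {N : ℕ} (hN : 1 ≤ N) {a : Fin (d + 1)} {x : Fin (d + 1) → ℤ} (h : IsIntBond N a x) :
    off N (bref α a x) = bbflip α N a (off N x) := by
  have e : bref α a x = (N : ℤ) • sref α (blk N x) + toSite (bbflip α N a (off N x)) := by
    conv_lhs => rw [← blk_add_off hN x]
    exact bref_block h (blk N x)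
  rw [e]
  have h2 := blk_add_off hN ((N : ℤ) • sref α (blk N x) + toSite (bbflip α N a (off N x)))
  rw [blk_block (sref α (blk N x)) (mem_bIdxSet.1 (bbflip_mem h)).1] at h2
  exact toSite_inj.1 (add_left_cancel h2)

/-- [folklore] Interior bonds reflect to interior bonds … -/
theorem isIntBond_bref {α : Fin (d + 1)} {N : ℕ} (hN : 1 ≤ N) {a : Fin (d + 1)} {x : Fin (d + 1) → ℤ} (h : IsIntBond N a x) :
    IsIntBond N a (bref α a x) := by
  unfold IsIntBond
  rw [off_bref_of_int hN h]
  exact bbflip_mem h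

/-- [folklore] … and only interior bonds do (the bond map is an involution). -/
theorem isIntBond_bref_iff {α : Fin (d + 1)} {N : ℕ} (hN : 1 ≤ N) (a : Fin (d + 1)) (x : Fin (d + 1) → ℤ) :
    IsIntBond N a (bref α a x) ↔ IsIntBond N a x := by
  constructor
  · intro h
    have := isIntBond_bref (α := α) hN h
    rwa [bref_bref] at this
  · exact isIntBond_bref hN

/-! ## §2 The reflection equivalences of the index types and the transport of `Gmat`, `Pmat` -/

/-- [our object] The reflection of interior bonds of block `0`. -/
def bRef (α : Fin (d + 1)) (N : ℕ) : BIdx (d + 1) N ≃ BIdx (d + 1) N where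
  toFun j := ⟨(j.1.1, bbflip α N j.1.1 j.1.2), bbflip_mem j.2⟩
  invFun j := ⟨(j.1.1, bbflip α N j.1.1 j.1.2), bbflip_mem j.2⟩
  left_inv j := by apply Subtype.ext; exact Prod.ext rfl (bbflip_bbflip j.2)
  right_inv j := by apply Subtype.ext; exact Prod.ext rfl (bbflip_bbflip j.2)

/-- [folklore] `bflip` fixes the centred root offset when `N` is odd. -/
theorem bflip_ctrOff {N : ℕ} (hN : Odd N) (α : Fin (d + 1)) : bflip α N (ctrOff (d + 1) N) = ctrOff (d + 1) N := by
  funext i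
  unfold bflip ctrOff
  obtain ⟨k, hk⟩ := hN
  subst hk
  split_ifs <;> omega

/-- [folklore] `bflip` preserves the non-root offsets (`N` odd). -/
theorem bflip_mem_cIdxSet {N : ℕ} (hN : Odd N) (α : Fin (d + 1)) {c : Fin (d + 1) → ℕ} (hc : c ∈ cIdxSet (d + 1) N) :
    bflip α N c ∈ cIdxSet (d + 1) N := by
  unfold cIdxSet at hc ⊢
  rw [Finset.mem_erase] at hc ⊢
  refine ⟨fun h => hc.1 ?_, bflip_mem α hc.2⟩
  have := congrArg (bflip α N) h
  rwa [bflip_bflip α hc.2, bflip_ctrOff hN] at this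

/-- [our object] The reflection of the non-root sites of block `0` (`N` odd). -/
def cRef {N : ℕ} (hN : Odd N) (α : Fin (d + 1)) : CIdx (d + 1) N ≃ CIdx (d + 1) N where
  toFun z := ⟨bflip α N z.1, bflip_mem_cIdxSet hN α z.2⟩
  invFun z := ⟨bflip α N z.1, bflip_mem_cIdxSet hN α z.2⟩
  left_inv z := by apply Subtype.ext; exact bflip_bflip α (Finset.mem_of_mem_erase z.2)
  right_inv z := by apply Subtype.ext; exact bflip_bflip α (Finset.mem_of_mem_erase z.2)

/-- [our object] The diagonal orientation-sign matrix on interior bonds. -/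
def Smat (α : Fin (d + 1)) (N : ℕ) : Matrix (BIdx (d + 1) N) (BIdx (d + 1) N) ℝ := Matrix.diagonal fun j => reflSign α j.1.1

/-- [folklore] `S Sᵀ = 1`. -/
theorem Smat_mul_transpose (α : Fin (d + 1)) (N : ℕ) : Smat (d := d) α N * (Smat α N)ᵀ = 1 := by
  unfold Smat
  rw [Matrix.diagonal_transpose, Matrix.diagonal_mul_diagonal, ← Matrix.diagonal_one]
  congr 1
  funext j
  exact reflSign_mul_self α j.1.1

/-- [folklore] **THE REFLECTION TRANSPORT OF `Gmat`** (`N` odd): `Gmat (z̄) (j̄) = ε_j · Gmat z j`, i.e. `(Gmat N).submatrix cRef bRef = Gmat N * S`. -/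
theorem Gmat_submatrix_refl {N : ℕ} (hN : Odd N) (α : Fin (d + 1)) :
    (Gmat (n := d + 1) N).submatrix (cRef hN α) (bRef α N) = Gmat N * Smat α N := by
  have hN1 : 1 ≤ N := hN.pos
  ext z j
  have hS : (Gmat (n := d + 1) N * Smat α N : Matrix (CIdx (d + 1) N) (BIdx (d + 1) N) ℝ) z j = Gmat N z j * reflSign α j.1.1 := by
    simp only [Smat, Matrix.mul_diagonal]
  rw [Matrix.submatrix_apply]
  refine Eq.trans ?_ hS.symm
  simp only [Gmat, cRef, bRef, Equiv.coe_fn_mk]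
  -- both reflected points live in the block `sref α 0`; translate back to block 0
  set B : Fin (d + 1) → ℤ := sref α 0 with hB
  have hz : toSite (bflip α N z.1) = sref α (toSite z.1) + (N : ℤ) • (-B) := by
    have := sref_block α (Finset.mem_of_mem_erase z.2) (0 : Fin (d + 1) → ℤ)
    rw [smul_zero, zero_add] at this
    rw [this, hB, smul_neg]; abel
  have hj : toSite (bbflip α N j.1.1 j.1.2) = bref α j.1.1 (toSite j.1.2) + (N : ℤ) • (-B) := by
    have := bref_block (α := α) j.2 (0 : Fin (d + 1) → ℤ)
    rw [smul_zero, zero_add] at this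
    rw [this, hB, smul_neg]; abel
  rw [hz, hj, bondIndR_shift, show -((N : ℤ) • -B) = (N : ℤ) • B by rw [smul_neg, neg_neg], symTreeGaugeAt_shift _ hN1,
    show sref α (toSite z.1) + (N : ℤ) • -B + (N : ℤ) • B = sref α (toSite z.1) by rw [smul_neg]; abel]
  -- the reflection law of the symmetrised tree gauge
  have key := congrFun (symTreeGaugeAt_R1 hN α (bondIndR j.1.1 (bref α j.1.1 (toSite j.1.2)))) (toSite z.1)
  rw [R0_apply] at key
  rw [← key]
  have hR : R1 α (bondIndR j.1.1 (bref α j.1.1 (toSite j.1.2))) = fun κ x => reflSign α j.1.1 * bondIndR j.1.1 (toSite j.1.2) κ x := by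
    have h := R1_bondInd α j.1.1 (toSite j.1.2)
    unfold bondIndR
    exact h
  rw [hR, symTreeGaugeAt_mulLeft, mul_comm]

/-- [folklore] **THE REFLECTION TRANSPORT OF `Pmat`** (`N` odd): `Pmat (ī) (j̄) = ε_i ε_j · Pmat i j`. -/
theorem Pmat_refl {N : ℕ} (hN : Odd N) (α : Fin (d + 1)) (i j : BIdx (d + 1) N) :
    Pmat N (bRef α N i) (bRef α N j) = reflSign α i.1.1 * Pmat N i j * reflSign α j.1.1 := by
  have h1 := kerProj_submatrix (Gmat (n := d + 1) N) (cRef hN α) (bRef α N)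
  rw [Gmat_submatrix_refl hN α] at h1
  have h2 := kerProj_mul_orthogonal (Gmat (n := d + 1) N) (Smat α N) (Smat_mul_transpose α N)
  have h3 := h2.symm.trans h1
  have hij := congrFun (congrFun h3 i) j
  rw [Matrix.submatrix_apply] at hij
  rw [Pmat, ← hij]
  simp only [Smat, Matrix.diagonal_transpose, Matrix.mul_diagonal, Matrix.diagonal_mul]

/-! ## §3 `symEc` is reflection-invariant -/

/-- [folklore] **`refK (Φ N α) (symEc N) = symEc N`** (`N` odd, every axis `α`; centred root). -/
theorem refK_symEc {N : ℕ} (hN : Odd N) (α : Fin (d + 1)) : refK (Φ N α) (symEc (d := d) N) = symEc N := by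
  have hN1 : 1 ≤ N := hN.pos
  haveI : NeZero N := ⟨by omega⟩
  funext x x' a b
  rw [refK_apply]
  rcases a with a | m <;> rcases b with b | m'
  · simp only [Φ_s_inl, Φ_r_inl]
    by_cases h : IsIntBond N a x ∧ IsIntBond N b x'
    · have h' : IsIntBond N a (bref α a x) ∧ IsIntBond N b (bref α b x') := ⟨isIntBond_bref hN1 h.1, isIntBond_bref hN1 h.2⟩
      rw [symEc_inl_inl_of_int h'.1 h'.2, symEc_inl_inl_of_int h.1 h.2, blk_bref_of_int hN1 h.1, blk_bref_of_int hN1 h.2]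
      by_cases hb : blk N x = blk N x'
      · rw [if_pos (by rw [hb]), if_pos hb]
        have e := Pmat_refl hN α ⟨(a, off N x), h.1⟩ ⟨(b, off N x'), h.2⟩
        have e' : Pmat N ⟨(a, off N (bref α a x)), h'.1⟩ ⟨(b, off N (bref α b x')), h'.2⟩ = Pmat N (bRef α N ⟨(a, off N x), h.1⟩) (bRef α N ⟨(b, off N x'), h.2⟩) := by
          congr 1 <;> apply Subtype.ext <;> simp only [bRef, Equiv.coe_fn_mk, off_bref_of_int hN1 h.1, off_bref_of_int hN1 h.2]
        rw [e', e]
        have hsa := reflSign_mul_self α a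
        have hsb := reflSign_mul_self α b
        calc reflSign α a * reflSign α b * (reflSign α a * Pmat N ⟨(a, off N x), h.1⟩ ⟨(b, off N x'), h.2⟩ * reflSign α b)
            = (reflSign α a * reflSign α a) * (reflSign α b * reflSign α b) * Pmat N ⟨(a, off N x), h.1⟩ ⟨(b, off N x'), h.2⟩ := by ring
          _ = Pmat N ⟨(a, off N x), h.1⟩ ⟨(b, off N x'), h.2⟩ := by rw [hsa, hsb, one_mul, one_mul]
      · rw [if_neg (fun e => hb (by simpa using congrArg (sref α) e)), if_neg hb, mul_zero]
    · have h' : ¬ (IsIntBond N a (bref α a x) ∧ IsIntBond N b (bref α b x')) := fun hh =>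
        h ⟨(isIntBond_bref_iff hN1 a x).1 hh.1, (isIntBond_bref_iff hN1 b x').1 hh.2⟩
      rw [symEc_inl_inl_of_not_int h', symEc_inl_inl_of_not_int h]
      by_cases hab : a = b
      · subst hab
        rw [reflSign_mul_self, one_mul]
        by_cases hx : x = x'
        · subst hx; simp
        · have hx' : bref α a x ≠ bref α a x' := fun e => hx (by simpa using congrArg (bref α a) e)
          rw [if_neg (fun hh => hx' hh.1), if_neg (fun hh => hx hh.1)]
      · rw [if_neg (fun hh => hab hh.2), if_neg (fun hh => hab hh.2), mul_zero]
  · simp [symEc_inl_inr]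
  · simp [symEc_inr_inl]
  · simp only [Φ_s_inr, Φ_r_inr, symEc_inr_inr]
    by_cases hm : m = m'
    · subst hm
      rw [reflSign_mul_self, one_mul]
      simp only [proj_mref_eq_zero_iff, true_and]
      by_cases hx : x = x'
      · subst hx; simp
      · have hx' : mref N α m x ≠ mref N α m x' := fun e => hx (by simpa using congrArg (mref N α m) e)
        rw [if_neg (fun hh => hx' hh.1), if_neg (fun hh => hx hh.1)]
    · rw [if_neg (fun hh => hm hh.2.1), if_neg (fun hh => hm hh.2.1), mul_zero]

end

end Summit.QuantumFields.BalabanUV.Beta.SymSliceProjectorRefl
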